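import Summits.HodgeConjecture.HodgeConjecture.Theorems.F0P3cStCharTSHleviOfClosedForms   -- ★ p849750 (this seat) `hlevi_of_closed_forms` (the `hc` binder shape)
import HarnessLib

/-!
# F0 · P3c · line LH6 «StCharTS» — road (D) «DEEP-FL», (D-c) kit B «HC OF COSETS»: the scalar identity `hc` of ★ `hlevi_of_closed_forms` from an oriented coset checklist —
# `Φ_H = Σ_j c_j κ_{H,j} 𝟙_{C_j} (+ flips off the stratum)`, `Φ_G = κ_G 𝟙_B (+ the anti-oriented shell)`, `τ_v` constant on each `C_j`, `c_j κ_{H,j} = τ_j κ_G`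

Cell `pub/hodgecm-mathlib`, crux H413 = `stmt-HodgeConjecture-24833` (lane `--supports … --as helper`), route HCCMUnconditional; seat LH6-p04 (g3); road owner of record LH6-p03 (g0),
ROAD-D status v5 `F0/P3b/LH6-p03/g0/ROAD-D.status.v5.txt` CHANGE 1 + (Q1) ruling 2026-09-02T06:15:27Z (`c_j := finTau(u_j)·κ_G∕κ_{H,j}`, no `finWeylRatio`).  THEOREMS ONLY, sorry-free,
★-only imports; no definition ∕ instance ∕ notation ∕ named fact.  HONEST LABEL: HC_CM is proved only modulo the 7 printed citations (2 remaining: hLiu418 = stmt-HodgeConjecture-24832,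
h413 = stmt-HodgeConjecture-24833) until rung 0 closes; count-neutral plumbing of road (D).

THE MATHEMATICS ([Rogawski1990, §4.9 Lemma 4.9.2, (4.9.4) p. 56; §12.7 L. 12.7.3 (proof) p. 195]).  ★ `hlevi_of_closed_forms` reduces the Levi identity `hlevi` to
`hc : Φ_H(t_H, u) = τ_v(γ_H) · Φ_G(t)` along the hyperbolic `G`-regular diagonal-Levi stratum (`t = ι_v γ_H`, `t_H = h₂`).  In ROAD-D v5 the two step functions are: `Φ_G` = the
two-coset function `κ_G · (𝟙_{B₁} + κ 𝟙_{B₂})` of ★ D3-ii-G, of which exactly ONE shell (`B`, the ORIENTED one, ★ `F0P3cStCharTSShellOrientation`) meets the stratum; `Φ_H` = the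
coset sum `Σ_{j∈s} c_j · κ_{H,j} · (𝟙_{C_j} + κ′_j 𝟙_{C′_j})` of the refined test function `f^H₀ = Σ_j c_j 𝟙_{K_H u_j K_H}` (★ kit A `hOH_of_summands`, ★ `F0P3cStCharTSCosetSum`),
whose cosets `C_j = u_j S′` partition the oriented shell and whose flips `C′_j` lie off the stratum.  If `τ_v = finTau` is constant (`= τ_j`) on each `C_j` (★
`F0P3cStCharTSDeltaCosetConst`) and `c_j κ_{H,j} = τ_j · κ_G κ` (the choice of `c_j`), then `hc` holds: on `C_j` both sides equal `τ_j κ_G κ`; off `⋃_j C_j` (hence off `B`) both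
vanish.  §1: the indicator algebra (any carrier); §2: the abstract checklist `hc_of_cosets` (values of `Φ_G` on∕off `B`, of `Φ_H` on `C_j` ∕ off `⋃ C_j`, covering, constancy,
choice); §3: the explicit two-coset ∕ coset-sum form `hc_of_cosetSum` (oriented shell = the `κ`-weighted one) and `hc_of_cosetSum'` (oriented shell = the first one).

## References
* [Rogawski1990] J. D. Rogawski, *Automorphic Representations of Unitary Groups in Three Variables*, Ann. of Math. Stud. 123 (1990): §4.9 Lemma 4.9.2, (4.9.4) p. 56;
  §12.7 Lemma 12.7.3 (proof) p. 195.
-/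

set_option autoImplicit false
-- the mandated namespace has the single-problem summit's repeated segment (`HodgeConjecture.HodgeConjecture`)
set_option linter.dupNamespace false

noncomputable section

open Matrix NumberField IsDedekindDomain
open scoped MatrixGroups
open Literature.NumberTheory.Rogawski1990 Literature.NumberTheory.Automorphic Literature.NumberTheory.Automorphic.UnitaryGroup
open Literature.NumberTheory.GaloisRepresentations

namespace Summit.HodgeConjecture.HodgeConjecture.Cruxes.H413.F0P3cStCharTSHleviCosets

/-! ## §1 Indicator algebra -/

section Algebra

variable {X ι : Type*}

/-- Two-coset step function at a point of the second shell only: `κ_G · (𝟙_{B₁}(t) + κ 𝟙_{B₂}(t)) = κ_G κ`. [cite: Rogawski1990, §4.9 (4.9.4) p. 56] -/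
theorem twoCoset_eq_of_not_mem_of_mem (B₁ B₂ : Set X) (κG κ : ℂ) {t : X} (h₁ : t ∉ B₁) (h₂ : t ∈ B₂) :
    κG * (B₁.indicator (fun _ => (1 : ℂ)) t + κ * B₂.indicator (fun _ => (1 : ℂ)) t) = κG * κ := by
  rw [Set.indicator_of_notMem h₁, Set.indicator_of_mem h₂, zero_add, mul_one]

/-- Two-coset step function at a point of the first shell only: `κ_G · (𝟙_{B₁}(t) + κ 𝟙_{B₂}(t)) = κ_G`. [cite: Rogawski1990, §4.9 (4.9.4) p. 56] -/
theorem twoCoset_eq_of_mem_of_not_mem (B₁ B₂ : Set X) (κG κ : ℂ) {t : X} (h₁ : t ∈ B₁) (h₂ : t ∉ B₂) :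
    κG * (B₁.indicator (fun _ => (1 : ℂ)) t + κ * B₂.indicator (fun _ => (1 : ℂ)) t) = κG := by
  rw [Set.indicator_of_mem h₁, Set.indicator_of_notMem h₂, mul_zero, add_zero, mul_one]

/-- Two-coset step function off both shells: `= 0`. [cite: Rogawski1990, §4.9 (4.9.4) p. 56] -/
theorem twoCoset_eq_zero_of_not_mem (B₁ B₂ : Set X) (κG κ : ℂ) {t : X} (h₁ : t ∉ B₁) (h₂ : t ∉ B₂) :
    κG * (B₁.indicator (fun _ => (1 : ℂ)) t + κ * B₂.indicator (fun _ => (1 : ℂ)) t) = 0 := by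
  rw [Set.indicator_of_notMem h₁, Set.indicator_of_notMem h₂, mul_zero, add_zero, mul_zero]

/-- **Coset sum at a point of the `j₀`-th coset** (cosets pairwise disjoint on `s`, the point off every flip; flip weights `κ′_j` may depend on `j`):
`Σ_{j∈s} c_j · (κ_{H,j} · (𝟙_{C_j}(x) + κ′_j 𝟙_{C′_j}(x))) = c_{j₀} κ_{H,j₀}`. [cite: Rogawski1990, §4.9 (4.9.4) p. 56; §12.7 L. 12.7.3 (proof) p. 195] -/
theorem cosetSum_eq_of_mem (s : Finset ι) (C C' : ι → Set X) (cj κH κ' : ι → ℂ) (hC : (s : Set ι).PairwiseDisjoint C)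
    {x : X} (hx' : ∀ j ∈ s, x ∉ C' j) {j₀ : ι} (hj₀ : j₀ ∈ s) (hx : x ∈ C j₀) :
    ∑ j ∈ s, cj j * (κH j * ((C j).indicator (fun _ => (1 : ℂ)) x + κ' j * (C' j).indicator (fun _ => (1 : ℂ)) x)) = cj j₀ * κH j₀ := by
  classical
  rw [← Finset.add_sum_erase s _ hj₀]
  have h1 : ∀ j ∈ s.erase j₀, cj j * (κH j * ((C j).indicator (fun _ => (1 : ℂ)) x + κ' j * (C' j).indicator (fun _ => (1 : ℂ)) x)) = 0 := by
    intro j hj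
    obtain ⟨hne, hjs⟩ := Finset.mem_erase.1 hj
    have hxC : x ∉ C j := fun h => (Set.disjoint_left.1 (hC hj₀ hjs hne.symm) hx) h
    rw [Set.indicator_of_notMem hxC, Set.indicator_of_notMem (hx' j hjs), mul_zero, add_zero, mul_zero, mul_zero]
  rw [Finset.sum_eq_zero h1, add_zero, Set.indicator_of_mem hx, Set.indicator_of_notMem (hx' j₀ hj₀), mul_zero, add_zero, mul_one]

/-- **Coset sum off every coset and every flip**: `= 0`. [cite: Rogawski1990, §4.9 (4.9.4) p. 56] -/
theorem cosetSum_eq_zero (s : Finset ι) (C C' : ι → Set X) (cj κH κ' : ι → ℂ) {x : X} (hx : ∀ j ∈ s, x ∉ C j) (hx' : ∀ j ∈ s, x ∉ C' j) :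
    ∑ j ∈ s, cj j * (κH j * ((C j).indicator (fun _ => (1 : ℂ)) x + κ' j * (C' j).indicator (fun _ => (1 : ℂ)) x)) = 0 :=
  Finset.sum_eq_zero fun j hj => by
    rw [Set.indicator_of_notMem (hx j hj), Set.indicator_of_notMem (hx' j hj), mul_zero, add_zero, mul_zero, mul_zero]

end Algebra

/-! ## §2 The abstract checklist -/

section CM

variable (L : Type) [Field L] [NumberField L] [IsCMField L] (v : HeightOneSpectrum (𝓞 ↥(maximalRealSubfield L)))
  (w : PlacesOver L v) (hw : IsCMField.complexConj L • w.1 = w.1)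

/-- **(D-c) kit B «HC OF COSETS», abstract form.**  Step functions `Φ_G : T₃ → ℂ`, `Φ_H : T₂ × U(Φ₁)_v → ℂ`, an oriented shell `B ⊆ T₃`, a finite family of cosets
`C_j ⊆ T₂ × U(Φ₁)_v` (`j ∈ s`), constants `τ_j, h_j, g_B`.  Along the hyperbolic `G`-regular diagonal-Levi stratum of `hlevi` (binders of ★ `hlevi_of_closed_forms` plus the torus points
`t_H = h₂`, `t = ι_v γ_H` it supplies) assume: (on∕off `B`) `Φ_G(t) = g_B` for `t ∈ B`, `= 0` for `t ∉ B`; (on `C_j` ∕ off `⋃ C_j`) `Φ_H(t_H, u) = h_j` on `C_j`, `= 0` off every `C_j`;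
(cov) `t ∈ B ⇒ (t_H, u) ∈ C_j` for some `j ∈ s`; (sub) `(t_H, u) ∈ C_j ⇒ t ∈ B`; (τ) `finTau L v γ_H μ = τ_j` on `C_j` (★ `F0P3cStCharTSDeltaCosetConst`); (val) `h_j = τ_j · g_B` (the
choice `c_j := τ_j·κ_G∕κ_{H,j}`).  THEN the `hc` clause of ★ `hlevi_of_closed_forms`: `Φ_H(t_H, u) = finTau L v γ_H μ · Φ_G(t)`. [cite: Rogawski1990, §4.9 Lemma 4.9.2, (4.9.4) p. 56;
§12.7 Lemma 12.7.3 (proof) p. 195] -/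
theorem hc_of_cosets (μ : HeckeCharacter L)
    (ΦG : ↥(cmBorelTriple L 3 v).M → ℂ)
    (ΦH : ↥(cmBorelTriple L 2 v).M × (cmDatum L 1 (Matrix.of fun i j : Fin 1 => if i.val + j.val + 1 = 1 then (1 : L) else 0)).Local v → ℂ)
    (B : Set ↥(cmBorelTriple L 3 v).M) {ι : Type*} (s : Finset ι)
    (C : ι → Set (↥(cmBorelTriple L 2 v).M × (cmDatum L 1 (Matrix.of fun i j : Fin 1 => if i.val + j.val + 1 = 1 then (1 : L) else 0)).Local v))
    (τ h : ι → ℂ) (gB : ℂ)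
    (hGon : ∀ (γH : ((cmDatum L 2 (Matrix.of fun i j : Fin 2 => if i.val + j.val + 1 = 2 then (1 : L) else 0)).Local v × (cmDatum L 1 (Matrix.of fun i j : Fin 1 => if i.val + j.val + 1 = 1 then (1 : L) else 0)).Local v))
      (d' : Fin 2 → (LocalRing L v)ˣ), glDiagonal 2 (LocalRing L v) d' = ((γH.1).val : GL (Fin 2) (LocalRing L v)) → IsLocalGRegular L v γH →
      Valued.v (((d' 1 : (LocalRing L v)ˣ) : LocalRing L v) w) < Valued.v (((d' 0 : (LocalRing L v)ˣ) : LocalRing L v) w) →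
      galAdicCompletionMap (L := L) (IsCMField.complexConj L) hw (((d' 0 : (LocalRing L v)ˣ) : LocalRing L v) w) * ((d' 1 : (LocalRing L v)ˣ) : LocalRing L v) w = 1 →
      ∀ (t : ↥(cmBorelTriple L 3 v).M), (t : ↥(unitaryGroupOfForm (conjLocal L (IsCMField.complexConj L) v) (cmLocalForm L 3 v))) = endoEmbLocal L v γH →
      t ∈ B → ΦG t = gB)
    (hGoff : ∀ (γH : ((cmDatum L 2 (Matrix.of fun i j : Fin 2 => if i.val + j.val + 1 = 2 then (1 : L) else 0)).Local v × (cmDatum L 1 (Matrix.of fun i j : Fin 1 => if i.val + j.val + 1 = 1 then (1 : L) else 0)).Local v))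
      (d' : Fin 2 → (LocalRing L v)ˣ), glDiagonal 2 (LocalRing L v) d' = ((γH.1).val : GL (Fin 2) (LocalRing L v)) → IsLocalGRegular L v γH →
      Valued.v (((d' 1 : (LocalRing L v)ˣ) : LocalRing L v) w) < Valued.v (((d' 0 : (LocalRing L v)ˣ) : LocalRing L v) w) →
      galAdicCompletionMap (L := L) (IsCMField.complexConj L) hw (((d' 0 : (LocalRing L v)ˣ) : LocalRing L v) w) * ((d' 1 : (LocalRing L v)ˣ) : LocalRing L v) w = 1 →
      ∀ (t : ↥(cmBorelTriple L 3 v).M), (t : ↥(unitaryGroupOfForm (conjLocal L (IsCMField.complexConj L) v) (cmLocalForm L 3 v))) = endoEmbLocal L v γH →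
      t ∉ B → ΦG t = 0)
    (hHon : ∀ (γH : ((cmDatum L 2 (Matrix.of fun i j : Fin 2 => if i.val + j.val + 1 = 2 then (1 : L) else 0)).Local v × (cmDatum L 1 (Matrix.of fun i j : Fin 1 => if i.val + j.val + 1 = 1 then (1 : L) else 0)).Local v))
      (d' : Fin 2 → (LocalRing L v)ˣ), glDiagonal 2 (LocalRing L v) d' = ((γH.1).val : GL (Fin 2) (LocalRing L v)) → IsLocalGRegular L v γH →
      Valued.v (((d' 1 : (LocalRing L v)ˣ) : LocalRing L v) w) < Valued.v (((d' 0 : (LocalRing L v)ˣ) : LocalRing L v) w) →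
      galAdicCompletionMap (L := L) (IsCMField.complexConj L) hw (((d' 0 : (LocalRing L v)ˣ) : LocalRing L v) w) * ((d' 1 : (LocalRing L v)ˣ) : LocalRing L v) w = 1 →
      ∀ (tH : ↥(cmBorelTriple L 2 v).M), (tH : ↥(unitaryGroupOfForm (conjLocal L (IsCMField.complexConj L) v) (cmLocalForm L 2 v))) = γH.1 →
      ∀ j ∈ s, (tH, γH.2) ∈ C j → ΦH (tH, γH.2) = h j)
    (hHoff : ∀ (γH : ((cmDatum L 2 (Matrix.of fun i j : Fin 2 => if i.val + j.val + 1 = 2 then (1 : L) else 0)).Local v × (cmDatum L 1 (Matrix.of fun i j : Fin 1 => if i.val + j.val + 1 = 1 then (1 : L) else 0)).Local v))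
      (d' : Fin 2 → (LocalRing L v)ˣ), glDiagonal 2 (LocalRing L v) d' = ((γH.1).val : GL (Fin 2) (LocalRing L v)) → IsLocalGRegular L v γH →
      Valued.v (((d' 1 : (LocalRing L v)ˣ) : LocalRing L v) w) < Valued.v (((d' 0 : (LocalRing L v)ˣ) : LocalRing L v) w) →
      galAdicCompletionMap (L := L) (IsCMField.complexConj L) hw (((d' 0 : (LocalRing L v)ˣ) : LocalRing L v) w) * ((d' 1 : (LocalRing L v)ˣ) : LocalRing L v) w = 1 →
      ∀ (tH : ↥(cmBorelTriple L 2 v).M), (tH : ↥(unitaryGroupOfForm (conjLocal L (IsCMField.complexConj L) v) (cmLocalForm L 2 v))) = γH.1 →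
      (∀ j ∈ s, (tH, γH.2) ∉ C j) → ΦH (tH, γH.2) = 0)
    (hcov : ∀ (γH : ((cmDatum L 2 (Matrix.of fun i j : Fin 2 => if i.val + j.val + 1 = 2 then (1 : L) else 0)).Local v × (cmDatum L 1 (Matrix.of fun i j : Fin 1 => if i.val + j.val + 1 = 1 then (1 : L) else 0)).Local v))
      (d' : Fin 2 → (LocalRing L v)ˣ), glDiagonal 2 (LocalRing L v) d' = ((γH.1).val : GL (Fin 2) (LocalRing L v)) → IsLocalGRegular L v γH →
      Valued.v (((d' 1 : (LocalRing L v)ˣ) : LocalRing L v) w) < Valued.v (((d' 0 : (LocalRing L v)ˣ) : LocalRing L v) w) →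
      galAdicCompletionMap (L := L) (IsCMField.complexConj L) hw (((d' 0 : (LocalRing L v)ˣ) : LocalRing L v) w) * ((d' 1 : (LocalRing L v)ˣ) : LocalRing L v) w = 1 →
      ∀ (tH : ↥(cmBorelTriple L 2 v).M), (tH : ↥(unitaryGroupOfForm (conjLocal L (IsCMField.complexConj L) v) (cmLocalForm L 2 v))) = γH.1 →
      ∀ (t : ↥(cmBorelTriple L 3 v).M), (t : ↥(unitaryGroupOfForm (conjLocal L (IsCMField.complexConj L) v) (cmLocalForm L 3 v))) = endoEmbLocal L v γH →
      t ∈ B → ∃ j ∈ s, (tH, γH.2) ∈ C j)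
    (hsub : ∀ (γH : ((cmDatum L 2 (Matrix.of fun i j : Fin 2 => if i.val + j.val + 1 = 2 then (1 : L) else 0)).Local v × (cmDatum L 1 (Matrix.of fun i j : Fin 1 => if i.val + j.val + 1 = 1 then (1 : L) else 0)).Local v))
      (d' : Fin 2 → (LocalRing L v)ˣ), glDiagonal 2 (LocalRing L v) d' = ((γH.1).val : GL (Fin 2) (LocalRing L v)) → IsLocalGRegular L v γH →
      Valued.v (((d' 1 : (LocalRing L v)ˣ) : LocalRing L v) w) < Valued.v (((d' 0 : (LocalRing L v)ˣ) : LocalRing L v) w) →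
      galAdicCompletionMap (L := L) (IsCMField.complexConj L) hw (((d' 0 : (LocalRing L v)ˣ) : LocalRing L v) w) * ((d' 1 : (LocalRing L v)ˣ) : LocalRing L v) w = 1 →
      ∀ (tH : ↥(cmBorelTriple L 2 v).M), (tH : ↥(unitaryGroupOfForm (conjLocal L (IsCMField.complexConj L) v) (cmLocalForm L 2 v))) = γH.1 →
      ∀ (t : ↥(cmBorelTriple L 3 v).M), (t : ↥(unitaryGroupOfForm (conjLocal L (IsCMField.complexConj L) v) (cmLocalForm L 3 v))) = endoEmbLocal L v γH →
      ∀ j ∈ s, (tH, γH.2) ∈ C j → t ∈ B)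
    (hτ : ∀ (γH : ((cmDatum L 2 (Matrix.of fun i j : Fin 2 => if i.val + j.val + 1 = 2 then (1 : L) else 0)).Local v × (cmDatum L 1 (Matrix.of fun i j : Fin 1 => if i.val + j.val + 1 = 1 then (1 : L) else 0)).Local v))
      (d' : Fin 2 → (LocalRing L v)ˣ), glDiagonal 2 (LocalRing L v) d' = ((γH.1).val : GL (Fin 2) (LocalRing L v)) → IsLocalGRegular L v γH →
      Valued.v (((d' 1 : (LocalRing L v)ˣ) : LocalRing L v) w) < Valued.v (((d' 0 : (LocalRing L v)ˣ) : LocalRing L v) w) →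
      galAdicCompletionMap (L := L) (IsCMField.complexConj L) hw (((d' 0 : (LocalRing L v)ˣ) : LocalRing L v) w) * ((d' 1 : (LocalRing L v)ˣ) : LocalRing L v) w = 1 →
      ∀ (tH : ↥(cmBorelTriple L 2 v).M), (tH : ↥(unitaryGroupOfForm (conjLocal L (IsCMField.complexConj L) v) (cmLocalForm L 2 v))) = γH.1 →
      ∀ j ∈ s, (tH, γH.2) ∈ C j → finTau L v γH μ = τ j)
    (hval : ∀ j ∈ s, h j = τ j * gB)
    -- the `hc` binders of ★ `hlevi_of_closed_forms`
    (γH : ((cmDatum L 2 (Matrix.of fun i j : Fin 2 => if i.val + j.val + 1 = 2 then (1 : L) else 0)).Local v × (cmDatum L 1 (Matrix.of fun i j : Fin 1 => if i.val + j.val + 1 = 1 then (1 : L) else 0)).Local v))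
    (d' : Fin 2 → (LocalRing L v)ˣ) (hd' : glDiagonal 2 (LocalRing L v) d' = ((γH.1).val : GL (Fin 2) (LocalRing L v))) (hreg : IsLocalGRegular L v γH)
    (hlt : Valued.v (((d' 1 : (LocalRing L v)ˣ) : LocalRing L v) w) < Valued.v (((d' 0 : (LocalRing L v)ˣ) : LocalRing L v) w))
    (h01 : galAdicCompletionMap (L := L) (IsCMField.complexConj L) hw (((d' 0 : (LocalRing L v)ˣ) : LocalRing L v) w) * ((d' 1 : (LocalRing L v)ˣ) : LocalRing L v) w = 1)
    (tH : ↥(cmBorelTriple L 2 v).M) (htH : (tH : ↥(unitaryGroupOfForm (conjLocal L (IsCMField.complexConj L) v) (cmLocalForm L 2 v))) = γH.1)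
    (t : ↥(cmBorelTriple L 3 v).M) (ht : (t : ↥(unitaryGroupOfForm (conjLocal L (IsCMField.complexConj L) v) (cmLocalForm L 3 v))) = endoEmbLocal L v γH) :
    ΦH (tH, γH.2) = finTau L v γH μ * ΦG t := by
  by_cases htB : t ∈ B
  · obtain ⟨j, hj, hx⟩ := hcov γH d' hd' hreg hlt h01 tH htH t ht htB
    rw [hHon γH d' hd' hreg hlt h01 tH htH j hj hx, hGon γH d' hd' hreg hlt h01 t ht htB, hval j hj, hτ γH d' hd' hreg hlt h01 tH htH j hj hx]
  · have hx : ∀ j ∈ s, (tH, γH.2) ∉ C j := fun j hj hx => htB (hsub γH d' hd' hreg hlt h01 tH htH t ht j hj hx)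
    rw [hHoff γH d' hd' hreg hlt h01 tH htH hx, hGoff γH d' hd' hreg hlt h01 t ht htB, mul_zero]

/-! ## §3 The explicit two-coset ∕ coset-sum form -/

/-- **(D-c) kit B «HC OF COSETS», explicit form (oriented shell = the `κ`-weighted one).**  `Φ_G := κ_G · (𝟙_{B₁} + κ · 𝟙_{B₂})` (★ D3-ii-G), `Φ_H := Σ_{j∈s} c_j · (κ_{H,j} · (𝟙_{C_j} +
κ′_j 𝟙_{C′_j}))` (★ kit A over ★ D3-ii-H).  Along the `hlevi` stratum assume: (orient) `t ∉ B₁` (★ `F0P3cStCharTSShellOrientation`: the ray `b·S_n` is anti-oriented); (flip) `(t_H, u) ∉ C′_j`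
for every `j ∈ s` (the flips lie in the other shell); (disj) the `C_j` pairwise disjoint on `s` (★ T-BASIS); (cov)∕(sub) `t ∈ B₂ ↔ (t_H, u) ∈ C_j` for some `j ∈ s` (`⨆_j C_j = Ψ⁻¹B₂`);
(τ) `finTau L v γ_H μ = τ_j` on `C_j` (★ DeltaCosetConst); (val) `c_j · κ_{H,j} = τ_j · (κ_G κ)`.  THEN `Φ_H(t_H, u) = finTau L v γ_H μ · Φ_G(t)` (the `hc` clause of ★
`hlevi_of_closed_forms` for these lambdas). [cite: Rogawski1990, §4.9 Lemma 4.9.2, (4.9.4) p. 56; §12.7 Lemma 12.7.3 (proof) p. 195] -/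
theorem hc_of_cosetSum (μ : HeckeCharacter L)
    (B₁ B₂ : Set ↥(cmBorelTriple L 3 v).M) (κG κ : ℂ) {ι : Type*} (s : Finset ι)
    (C C' : ι → Set (↥(cmBorelTriple L 2 v).M × (cmDatum L 1 (Matrix.of fun i j : Fin 1 => if i.val + j.val + 1 = 1 then (1 : L) else 0)).Local v))
    (cj κH κ' τ : ι → ℂ) (hC : (s : Set ι).PairwiseDisjoint C)
    (horient : ∀ (γH : ((cmDatum L 2 (Matrix.of fun i j : Fin 2 => if i.val + j.val + 1 = 2 then (1 : L) else 0)).Local v × (cmDatum L 1 (Matrix.of fun i j : Fin 1 => if i.val + j.val + 1 = 1 then (1 : L) else 0)).Local v))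
      (d' : Fin 2 → (LocalRing L v)ˣ), glDiagonal 2 (LocalRing L v) d' = ((γH.1).val : GL (Fin 2) (LocalRing L v)) → IsLocalGRegular L v γH →
      Valued.v (((d' 1 : (LocalRing L v)ˣ) : LocalRing L v) w) < Valued.v (((d' 0 : (LocalRing L v)ˣ) : LocalRing L v) w) →
      galAdicCompletionMap (L := L) (IsCMField.complexConj L) hw (((d' 0 : (LocalRing L v)ˣ) : LocalRing L v) w) * ((d' 1 : (LocalRing L v)ˣ) : LocalRing L v) w = 1 →
      ∀ (t : ↥(cmBorelTriple L 3 v).M), (t : ↥(unitaryGroupOfForm (conjLocal L (IsCMField.complexConj L) v) (cmLocalForm L 3 v))) = endoEmbLocal L v γH →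
      t ∉ B₁)
    (hflip : ∀ (γH : ((cmDatum L 2 (Matrix.of fun i j : Fin 2 => if i.val + j.val + 1 = 2 then (1 : L) else 0)).Local v × (cmDatum L 1 (Matrix.of fun i j : Fin 1 => if i.val + j.val + 1 = 1 then (1 : L) else 0)).Local v))
      (d' : Fin 2 → (LocalRing L v)ˣ), glDiagonal 2 (LocalRing L v) d' = ((γH.1).val : GL (Fin 2) (LocalRing L v)) → IsLocalGRegular L v γH →
      Valued.v (((d' 1 : (LocalRing L v)ˣ) : LocalRing L v) w) < Valued.v (((d' 0 : (LocalRing L v)ˣ) : LocalRing L v) w) →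
      galAdicCompletionMap (L := L) (IsCMField.complexConj L) hw (((d' 0 : (LocalRing L v)ˣ) : LocalRing L v) w) * ((d' 1 : (LocalRing L v)ˣ) : LocalRing L v) w = 1 →
      ∀ (tH : ↥(cmBorelTriple L 2 v).M), (tH : ↥(unitaryGroupOfForm (conjLocal L (IsCMField.complexConj L) v) (cmLocalForm L 2 v))) = γH.1 →
      ∀ j ∈ s, (tH, γH.2) ∉ C' j)
    (hcov : ∀ (γH : ((cmDatum L 2 (Matrix.of fun i j : Fin 2 => if i.val + j.val + 1 = 2 then (1 : L) else 0)).Local v × (cmDatum L 1 (Matrix.of fun i j : Fin 1 => if i.val + j.val + 1 = 1 then (1 : L) else 0)).Local v))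
      (d' : Fin 2 → (LocalRing L v)ˣ), glDiagonal 2 (LocalRing L v) d' = ((γH.1).val : GL (Fin 2) (LocalRing L v)) → IsLocalGRegular L v γH →
      Valued.v (((d' 1 : (LocalRing L v)ˣ) : LocalRing L v) w) < Valued.v (((d' 0 : (LocalRing L v)ˣ) : LocalRing L v) w) →
      galAdicCompletionMap (L := L) (IsCMField.complexConj L) hw (((d' 0 : (LocalRing L v)ˣ) : LocalRing L v) w) * ((d' 1 : (LocalRing L v)ˣ) : LocalRing L v) w = 1 →
      ∀ (tH : ↥(cmBorelTriple L 2 v).M), (tH : ↥(unitaryGroupOfForm (conjLocal L (IsCMField.complexConj L) v) (cmLocalForm L 2 v))) = γH.1 →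
      ∀ (t : ↥(cmBorelTriple L 3 v).M), (t : ↥(unitaryGroupOfForm (conjLocal L (IsCMField.complexConj L) v) (cmLocalForm L 3 v))) = endoEmbLocal L v γH →
      t ∈ B₂ → ∃ j ∈ s, (tH, γH.2) ∈ C j)
    (hsub : ∀ (γH : ((cmDatum L 2 (Matrix.of fun i j : Fin 2 => if i.val + j.val + 1 = 2 then (1 : L) else 0)).Local v × (cmDatum L 1 (Matrix.of fun i j : Fin 1 => if i.val + j.val + 1 = 1 then (1 : L) else 0)).Local v))
      (d' : Fin 2 → (LocalRing L v)ˣ), glDiagonal 2 (LocalRing L v) d' = ((γH.1).val : GL (Fin 2) (LocalRing L v)) → IsLocalGRegular L v γH →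
      Valued.v (((d' 1 : (LocalRing L v)ˣ) : LocalRing L v) w) < Valued.v (((d' 0 : (LocalRing L v)ˣ) : LocalRing L v) w) →
      galAdicCompletionMap (L := L) (IsCMField.complexConj L) hw (((d' 0 : (LocalRing L v)ˣ) : LocalRing L v) w) * ((d' 1 : (LocalRing L v)ˣ) : LocalRing L v) w = 1 →
      ∀ (tH : ↥(cmBorelTriple L 2 v).M), (tH : ↥(unitaryGroupOfForm (conjLocal L (IsCMField.complexConj L) v) (cmLocalForm L 2 v))) = γH.1 →
      ∀ (t : ↥(cmBorelTriple L 3 v).M), (t : ↥(unitaryGroupOfForm (conjLocal L (IsCMField.complexConj L) v) (cmLocalForm L 3 v))) = endoEmbLocal L v γH →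
      ∀ j ∈ s, (tH, γH.2) ∈ C j → t ∈ B₂)
    (hτ : ∀ (γH : ((cmDatum L 2 (Matrix.of fun i j : Fin 2 => if i.val + j.val + 1 = 2 then (1 : L) else 0)).Local v × (cmDatum L 1 (Matrix.of fun i j : Fin 1 => if i.val + j.val + 1 = 1 then (1 : L) else 0)).Local v))
      (d' : Fin 2 → (LocalRing L v)ˣ), glDiagonal 2 (LocalRing L v) d' = ((γH.1).val : GL (Fin 2) (LocalRing L v)) → IsLocalGRegular L v γH →
      Valued.v (((d' 1 : (LocalRing L v)ˣ) : LocalRing L v) w) < Valued.v (((d' 0 : (LocalRing L v)ˣ) : LocalRing L v) w) →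
      galAdicCompletionMap (L := L) (IsCMField.complexConj L) hw (((d' 0 : (LocalRing L v)ˣ) : LocalRing L v) w) * ((d' 1 : (LocalRing L v)ˣ) : LocalRing L v) w = 1 →
      ∀ (tH : ↥(cmBorelTriple L 2 v).M), (tH : ↥(unitaryGroupOfForm (conjLocal L (IsCMField.complexConj L) v) (cmLocalForm L 2 v))) = γH.1 →
      ∀ j ∈ s, (tH, γH.2) ∈ C j → finTau L v γH μ = τ j)
    (hval : ∀ j ∈ s, cj j * κH j = τ j * (κG * κ))
    -- the `hc` binders of ★ `hlevi_of_closed_forms`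
    (γH : ((cmDatum L 2 (Matrix.of fun i j : Fin 2 => if i.val + j.val + 1 = 2 then (1 : L) else 0)).Local v × (cmDatum L 1 (Matrix.of fun i j : Fin 1 => if i.val + j.val + 1 = 1 then (1 : L) else 0)).Local v))
    (d' : Fin 2 → (LocalRing L v)ˣ) (hd' : glDiagonal 2 (LocalRing L v) d' = ((γH.1).val : GL (Fin 2) (LocalRing L v))) (hreg : IsLocalGRegular L v γH)
    (hlt : Valued.v (((d' 1 : (LocalRing L v)ˣ) : LocalRing L v) w) < Valued.v (((d' 0 : (LocalRing L v)ˣ) : LocalRing L v) w))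
    (h01 : galAdicCompletionMap (L := L) (IsCMField.complexConj L) hw (((d' 0 : (LocalRing L v)ˣ) : LocalRing L v) w) * ((d' 1 : (LocalRing L v)ˣ) : LocalRing L v) w = 1)
    (tH : ↥(cmBorelTriple L 2 v).M) (htH : (tH : ↥(unitaryGroupOfForm (conjLocal L (IsCMField.complexConj L) v) (cmLocalForm L 2 v))) = γH.1)
    (t : ↥(cmBorelTriple L 3 v).M) (ht : (t : ↥(unitaryGroupOfForm (conjLocal L (IsCMField.complexConj L) v) (cmLocalForm L 3 v))) = endoEmbLocal L v γH) :
    (fun x : ↥(cmBorelTriple L 2 v).M × (cmDatum L 1 (Matrix.of fun i j : Fin 1 => if i.val + j.val + 1 = 1 then (1 : L) else 0)).Local v =>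
        ∑ j ∈ s, cj j * (κH j * ((C j).indicator (fun _ => (1 : ℂ)) x + κ' j * (C' j).indicator (fun _ => (1 : ℂ)) x))) (tH, γH.2) =
      finTau L v γH μ * (fun t : ↥(cmBorelTriple L 3 v).M => κG * (B₁.indicator (fun _ => (1 : ℂ)) t + κ * B₂.indicator (fun _ => (1 : ℂ)) t)) t := by
  refine hc_of_cosets L v w hw μ (fun t : ↥(cmBorelTriple L 3 v).M => κG * (B₁.indicator (fun _ => (1 : ℂ)) t + κ * B₂.indicator (fun _ => (1 : ℂ)) t))
    (fun x : ↥(cmBorelTriple L 2 v).M × (cmDatum L 1 (Matrix.of fun i j : Fin 1 => if i.val + j.val + 1 = 1 then (1 : L) else 0)).Local v =>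
      ∑ j ∈ s, cj j * (κH j * ((C j).indicator (fun _ => (1 : ℂ)) x + κ' j * (C' j).indicator (fun _ => (1 : ℂ)) x)))
    B₂ s C τ (fun j => cj j * κH j) (κG * κ) ?_ ?_ ?_ ?_ hcov hsub hτ hval γH d' hd' hreg hlt h01 tH htH t ht
  · intro γH d' hd' hreg hlt h01 t ht htB
    exact twoCoset_eq_of_not_mem_of_mem B₁ B₂ κG κ (horient γH d' hd' hreg hlt h01 t ht) htB
  · intro γH d' hd' hreg hlt h01 t ht htB
    exact twoCoset_eq_zero_of_not_mem B₁ B₂ κG κ (horient γH d' hd' hreg hlt h01 t ht) htB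
  · intro γH d' hd' hreg hlt h01 tH htH j hj hx
    exact cosetSum_eq_of_mem s C C' cj κH κ' hC (hflip γH d' hd' hreg hlt h01 tH htH) hj hx
  · intro γH d' hd' hreg hlt h01 tH htH hx
    exact cosetSum_eq_zero s C C' cj κH κ' hx (hflip γH d' hd' hreg hlt h01 tH htH)

/-- **(D-c) kit B «HC OF COSETS», explicit form (oriented shell = the FIRST one).**  As `hc_of_cosetSum` with the roles of `B₁, B₂` exchanged: (orient) `t ∉ B₂`, (cov)∕(sub) for
`B₁`, (val) `c_j · κ_{H,j} = τ_j · κ_G`. [cite: Rogawski1990, §4.9 Lemma 4.9.2, (4.9.4) p. 56; §12.7 Lemma 12.7.3 (proof) p. 195] -/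
theorem hc_of_cosetSum' (μ : HeckeCharacter L)
    (B₁ B₂ : Set ↥(cmBorelTriple L 3 v).M) (κG κ : ℂ) {ι : Type*} (s : Finset ι)
    (C C' : ι → Set (↥(cmBorelTriple L 2 v).M × (cmDatum L 1 (Matrix.of fun i j : Fin 1 => if i.val + j.val + 1 = 1 then (1 : L) else 0)).Local v))
    (cj κH κ' τ : ι → ℂ) (hC : (s : Set ι).PairwiseDisjoint C)
    (horient : ∀ (γH : ((cmDatum L 2 (Matrix.of fun i j : Fin 2 => if i.val + j.val + 1 = 2 then (1 : L) else 0)).Local v × (cmDatum L 1 (Matrix.of fun i j : Fin 1 => if i.val + j.val + 1 = 1 then (1 : L) else 0)).Local v))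
      (d' : Fin 2 → (LocalRing L v)ˣ), glDiagonal 2 (LocalRing L v) d' = ((γH.1).val : GL (Fin 2) (LocalRing L v)) → IsLocalGRegular L v γH →
      Valued.v (((d' 1 : (LocalRing L v)ˣ) : LocalRing L v) w) < Valued.v (((d' 0 : (LocalRing L v)ˣ) : LocalRing L v) w) →
      galAdicCompletionMap (L := L) (IsCMField.complexConj L) hw (((d' 0 : (LocalRing L v)ˣ) : LocalRing L v) w) * ((d' 1 : (LocalRing L v)ˣ) : LocalRing L v) w = 1 →
      ∀ (t : ↥(cmBorelTriple L 3 v).M), (t : ↥(unitaryGroupOfForm (conjLocal L (IsCMField.complexConj L) v) (cmLocalForm L 3 v))) = endoEmbLocal L v γH →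
      t ∉ B₂)
    (hflip : ∀ (γH : ((cmDatum L 2 (Matrix.of fun i j : Fin 2 => if i.val + j.val + 1 = 2 then (1 : L) else 0)).Local v × (cmDatum L 1 (Matrix.of fun i j : Fin 1 => if i.val + j.val + 1 = 1 then (1 : L) else 0)).Local v))
      (d' : Fin 2 → (LocalRing L v)ˣ), glDiagonal 2 (LocalRing L v) d' = ((γH.1).val : GL (Fin 2) (LocalRing L v)) → IsLocalGRegular L v γH →
      Valued.v (((d' 1 : (LocalRing L v)ˣ) : LocalRing L v) w) < Valued.v (((d' 0 : (LocalRing L v)ˣ) : LocalRing L v) w) →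
      galAdicCompletionMap (L := L) (IsCMField.complexConj L) hw (((d' 0 : (LocalRing L v)ˣ) : LocalRing L v) w) * ((d' 1 : (LocalRing L v)ˣ) : LocalRing L v) w = 1 →
      ∀ (tH : ↥(cmBorelTriple L 2 v).M), (tH : ↥(unitaryGroupOfForm (conjLocal L (IsCMField.complexConj L) v) (cmLocalForm L 2 v))) = γH.1 →
      ∀ j ∈ s, (tH, γH.2) ∉ C' j)
    (hcov : ∀ (γH : ((cmDatum L 2 (Matrix.of fun i j : Fin 2 => if i.val + j.val + 1 = 2 then (1 : L) else 0)).Local v × (cmDatum L 1 (Matrix.of fun i j : Fin 1 => if i.val + j.val + 1 = 1 then (1 : L) else 0)).Local v))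
      (d' : Fin 2 → (LocalRing L v)ˣ), glDiagonal 2 (LocalRing L v) d' = ((γH.1).val : GL (Fin 2) (LocalRing L v)) → IsLocalGRegular L v γH →
      Valued.v (((d' 1 : (LocalRing L v)ˣ) : LocalRing L v) w) < Valued.v (((d' 0 : (LocalRing L v)ˣ) : LocalRing L v) w) →
      galAdicCompletionMap (L := L) (IsCMField.complexConj L) hw (((d' 0 : (LocalRing L v)ˣ) : LocalRing L v) w) * ((d' 1 : (LocalRing L v)ˣ) : LocalRing L v) w = 1 →
      ∀ (tH : ↥(cmBorelTriple L 2 v).M), (tH : ↥(unitaryGroupOfForm (conjLocal L (IsCMField.complexConj L) v) (cmLocalForm L 2 v))) = γH.1 →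
      ∀ (t : ↥(cmBorelTriple L 3 v).M), (t : ↥(unitaryGroupOfForm (conjLocal L (IsCMField.complexConj L) v) (cmLocalForm L 3 v))) = endoEmbLocal L v γH →
      t ∈ B₁ → ∃ j ∈ s, (tH, γH.2) ∈ C j)
    (hsub : ∀ (γH : ((cmDatum L 2 (Matrix.of fun i j : Fin 2 => if i.val + j.val + 1 = 2 then (1 : L) else 0)).Local v × (cmDatum L 1 (Matrix.of fun i j : Fin 1 => if i.val + j.val + 1 = 1 then (1 : L) else 0)).Local v))
      (d' : Fin 2 → (LocalRing L v)ˣ), glDiagonal 2 (LocalRing L v) d' = ((γH.1).val : GL (Fin 2) (LocalRing L v)) → IsLocalGRegular L v γH →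
      Valued.v (((d' 1 : (LocalRing L v)ˣ) : LocalRing L v) w) < Valued.v (((d' 0 : (LocalRing L v)ˣ) : LocalRing L v) w) →
      galAdicCompletionMap (L := L) (IsCMField.complexConj L) hw (((d' 0 : (LocalRing L v)ˣ) : LocalRing L v) w) * ((d' 1 : (LocalRing L v)ˣ) : LocalRing L v) w = 1 →
      ∀ (tH : ↥(cmBorelTriple L 2 v).M), (tH : ↥(unitaryGroupOfForm (conjLocal L (IsCMField.complexConj L) v) (cmLocalForm L 2 v))) = γH.1 →
      ∀ (t : ↥(cmBorelTriple L 3 v).M), (t : ↥(unitaryGroupOfForm (conjLocal L (IsCMField.complexConj L) v) (cmLocalForm L 3 v))) = endoEmbLocal L v γH →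
      ∀ j ∈ s, (tH, γH.2) ∈ C j → t ∈ B₁)
    (hτ : ∀ (γH : ((cmDatum L 2 (Matrix.of fun i j : Fin 2 => if i.val + j.val + 1 = 2 then (1 : L) else 0)).Local v × (cmDatum L 1 (Matrix.of fun i j : Fin 1 => if i.val + j.val + 1 = 1 then (1 : L) else 0)).Local v))
      (d' : Fin 2 → (LocalRing L v)ˣ), glDiagonal 2 (LocalRing L v) d' = ((γH.1).val : GL (Fin 2) (LocalRing L v)) → IsLocalGRegular L v γH →
      Valued.v (((d' 1 : (LocalRing L v)ˣ) : LocalRing L v) w) < Valued.v (((d' 0 : (LocalRing L v)ˣ) : LocalRing L v) w) →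
      galAdicCompletionMap (L := L) (IsCMField.complexConj L) hw (((d' 0 : (LocalRing L v)ˣ) : LocalRing L v) w) * ((d' 1 : (LocalRing L v)ˣ) : LocalRing L v) w = 1 →
      ∀ (tH : ↥(cmBorelTriple L 2 v).M), (tH : ↥(unitaryGroupOfForm (conjLocal L (IsCMField.complexConj L) v) (cmLocalForm L 2 v))) = γH.1 →
      ∀ j ∈ s, (tH, γH.2) ∈ C j → finTau L v γH μ = τ j)
    (hval : ∀ j ∈ s, cj j * κH j = τ j * κG)
    (γH : ((cmDatum L 2 (Matrix.of fun i j : Fin 2 => if i.val + j.val + 1 = 2 then (1 : L) else 0)).Local v × (cmDatum L 1 (Matrix.of fun i j : Fin 1 => if i.val + j.val + 1 = 1 then (1 : L) else 0)).Local v))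
    (d' : Fin 2 → (LocalRing L v)ˣ) (hd' : glDiagonal 2 (LocalRing L v) d' = ((γH.1).val : GL (Fin 2) (LocalRing L v))) (hreg : IsLocalGRegular L v γH)
    (hlt : Valued.v (((d' 1 : (LocalRing L v)ˣ) : LocalRing L v) w) < Valued.v (((d' 0 : (LocalRing L v)ˣ) : LocalRing L v) w))
    (h01 : galAdicCompletionMap (L := L) (IsCMField.complexConj L) hw (((d' 0 : (LocalRing L v)ˣ) : LocalRing L v) w) * ((d' 1 : (LocalRing L v)ˣ) : LocalRing L v) w = 1)
    (tH : ↥(cmBorelTriple L 2 v).M) (htH : (tH : ↥(unitaryGroupOfForm (conjLocal L (IsCMField.complexConj L) v) (cmLocalForm L 2 v))) = γH.1)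
    (t : ↥(cmBorelTriple L 3 v).M) (ht : (t : ↥(unitaryGroupOfForm (conjLocal L (IsCMField.complexConj L) v) (cmLocalForm L 3 v))) = endoEmbLocal L v γH) :
    (fun x : ↥(cmBorelTriple L 2 v).M × (cmDatum L 1 (Matrix.of fun i j : Fin 1 => if i.val + j.val + 1 = 1 then (1 : L) else 0)).Local v =>
        ∑ j ∈ s, cj j * (κH j * ((C j).indicator (fun _ => (1 : ℂ)) x + κ' j * (C' j).indicator (fun _ => (1 : ℂ)) x))) (tH, γH.2) =
      finTau L v γH μ * (fun t : ↥(cmBorelTriple L 3 v).M => κG * (B₁.indicator (fun _ => (1 : ℂ)) t + κ * B₂.indicator (fun _ => (1 : ℂ)) t)) t := by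
  refine hc_of_cosets L v w hw μ (fun t : ↥(cmBorelTriple L 3 v).M => κG * (B₁.indicator (fun _ => (1 : ℂ)) t + κ * B₂.indicator (fun _ => (1 : ℂ)) t))
    (fun x : ↥(cmBorelTriple L 2 v).M × (cmDatum L 1 (Matrix.of fun i j : Fin 1 => if i.val + j.val + 1 = 1 then (1 : L) else 0)).Local v =>
      ∑ j ∈ s, cj j * (κH j * ((C j).indicator (fun _ => (1 : ℂ)) x + κ' j * (C' j).indicator (fun _ => (1 : ℂ)) x)))
    B₁ s C τ (fun j => cj j * κH j) κG ?_ ?_ ?_ ?_ hcov hsub hτ hval γH d' hd' hreg hlt h01 tH htH t ht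
  · intro γH d' hd' hreg hlt h01 t ht htB
    exact twoCoset_eq_of_mem_of_not_mem B₁ B₂ κG κ htB (horient γH d' hd' hreg hlt h01 t ht)
  · intro γH d' hd' hreg hlt h01 t ht htB
    exact twoCoset_eq_zero_of_not_mem B₁ B₂ κG κ htB (horient γH d' hd' hreg hlt h01 t ht)
  · intro γH d' hd' hreg hlt h01 tH htH j hj hx
    exact cosetSum_eq_of_mem s C C' cj κH κ' hC (hflip γH d' hd' hreg hlt h01 tH htH) hj hx
  · intro γH d' hd' hreg hlt h01 tH htH hx
    exact cosetSum_eq_zero s C C' cj κH κ' hx (hflip γH d' hd' hreg hlt h01 tH htH)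

end CM

end Summit.HodgeConjecture.HodgeConjecture.Cruxes.H413.F0P3cStCharTSHleviCosets

end
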